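import Literature.MathematicalPhysics.StatisticalMechanics.MuGroundStateConfiguration
import Literature.Probability.Process.LocallyMatches
import HarnessLib

/-!
# `BallMatch` about a centre is `LocallyMatches` after recentring

Topic: `Literature/MathematicalPhysics/StatisticalMechanics`. Bridge between the two two-way
matching predicates of the tree:

* `BallMatch δ R c A S` (`MuGroundStateConfiguration.lean`, general pseudometric space, centre
  `c`, used by `IsLocalLimitOfGroundStates` and by the sequential compactness theorem
  `exists_subseq_forall_eventually_ballMatch` of `LocalMatchingCompactness.lean`), and
* `Literature.Probability.Process.LocallyMatches R ε S T` (`Probability/Process/LocallyMatches.lean`,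
  normed groups, centred at the root `0`, the entourage of the local rubber metric
  `LocalRubberMetric.lean` and of the rooted configurations of `PointStationaryLaw.lean`).

They agree: `ballMatch_zero_iff_locallyMatches` (centre `0`: literally the same clause with
`dist p 0 = ‖p‖`) and `ballMatch_iff_locallyMatches_image_sub` (general centre `c`: recentre both
sets at `c`). Hence every statement about one transfers to the other (e.g. the compactness of
`LocalConfig` / the sequential compactness of `δ`-separated sets).
-/

namespace Literature.MathematicalPhysics.StatisticalMechanics

open Literature.Probability.Process Set

variable {E : Type*} [SeminormedAddCommGroup E] {δ R : ℝ}

/-- **`BallMatch` about the origin is `LocallyMatches`**: `BallMatch δ R 0 A S ↔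
LocallyMatches R δ A S` (tolerance `δ`, radius `R`; `dist p 0 = ‖p‖`). [folklore] -/
theorem ballMatch_zero_iff_locallyMatches {A S : Set E} :
    BallMatch δ R 0 A S ↔ LocallyMatches R δ A S := by
  simp only [BallMatch, LocallyMatches, dist_zero_right]

/-- **`BallMatch` about `c` is `LocallyMatches` of the recentred sets** `A - c`, `S - c`
(translations are isometries, `dist (s - c) 0 = dist s c`). [folklore] -/
theorem ballMatch_iff_locallyMatches_image_sub {c : E} {A S : Set E} :
    BallMatch δ R c A S ↔
      LocallyMatches R δ ((fun z => z - c) '' A) ((fun z => z - c) '' S) := by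
  simp only [BallMatch, LocallyMatches, forall_mem_image, exists_mem_image, dist_sub_right,
    ← dist_eq_norm]

end Literature.MathematicalPhysics.StatisticalMechanics
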